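/-
Origin: expansion seat `planner-pub-hodgecm-pv14-g6-0`, handover import Pv14g6.SchwartzHyperbolicFlow -> import HodgeCM.Automorphic.SchwartzHyperbolicFlow ; after t31 row 10 (SchwartzHyperbolicFlow) (`HOME/pub-hodgecm-pv14-g6/lean/Pv14g6/SchwartzInvolFlowTransport.lean`, md5 f9b9a159, 131 lines);
landed by the gen-8 packager in gate run 31 as `HodgeCM/Automorphic/SchwartzInvolFlowTransport.lean` (import ^import Pv14g6\.SchwartzHyperbolicFlow[ \t]*$→import HodgeCM.Automorphic.SchwartzHyperbolicFlow ×1).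
-/
/-
Copyright: HodgeCM public adjudication package, seat pub-hodgecm-pv14-g6 (DAG-NODE PROVER #14, gen 6).
File #27 of this seat.  Kernel-checked, no new axioms.  Imports file #25 of this seat and Mathlib only.
-/
import Summits.HodgeConjecture.HodgeCM.Automorphic.SchwartzHyperbolicFlow

/-!
# Transport of the involutive-flow calculus to any family with the same matrix

File #25 proves the Schwartz-topology differentiability of `Φ ↦ Φ ∘ exp(sJ)` for the specific family
`involFlow J hJ s` (`exp(sJ) = cosh s · 1 + sinh s · J`, `J² = 1`).  Consumers build their flows
differently (e.g. by transporting a coordinate formula along `EuclideanSpace.equiv`) and then prove an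
identity `↑(g s) = cosh s • 1 + sinh s • J`.  This file turns that identity into the conclusions:

* `eq_involFlow_of_coe_eq` : such a `g : ℝ → (E ≃L[ℝ] E)` IS `involFlow J hJ` (continuous linear
  equivalences are determined by their underlying maps), also from the pointwise form
  `eq_involFlow_of_apply_eq`;
* hence, for such `g`, at every base point and for real or complex scalars:
  `tendsto_compCLM_sub_div_at_of_coe_eq`, `hasDerivAt_apply_compCLM_of_coe_eq`,
  `contDiff_apply_compCLM_of_coe_eq`, `iteratedDeriv_apply_compCLM_of_coe_eq`,
  `tendsto_compCLM_sub_div_ofReal_at_of_coe_eq`, and the literal smooth-vector-clause shape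
  `tendsto_compCLM_sub_div_ofReal_of_coe_eq :
     ((s : ℂ))⁻¹ • (Φ ∘ g s - Φ) → flowGen J Φ` (`s → 0`, `s ≠ 0`).

Only published mathematics is used (Mathlib); nothing here refers to the objects under adjudication.
-/

noncomputable section

open Filter Topology
open scoped SchwartzMap ContDiff

namespace HodgeCM
namespace SchwartzWeil

section Uniqueness

variable {E : Type*} [NormedAddCommGroup E] [NormedSpace ℝ E] {J : E →L[ℝ] E} (hJ : J * J = 1)
  {g : ℝ → (E ≃L[ℝ] E)}

/-- A family of continuous linear automorphisms whose matrices are `cosh s · 1 + sinh s · J` is the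
flow `involFlow J hJ`. -/
theorem eq_involFlow_of_coe_eq
    (hg : ∀ s, ((g s : E ≃L[ℝ] E) : E →L[ℝ] E) = Real.cosh s • (1 : E →L[ℝ] E) + Real.sinh s • J) :
    g = involFlow J hJ := by
  funext s
  refine ContinuousLinearEquiv.ext ?_
  have h : ((g s : E ≃L[ℝ] E) : E →L[ℝ] E) = ((involFlow J hJ s : E ≃L[ℝ] E) : E →L[ℝ] E) := by
    rw [hg s, coe_involFlow]; rfl
  exact congrArg (fun T : E →L[ℝ] E => (T : E → E)) h

/-- The same from the pointwise formula `g s x = cosh s • x + sinh s • J x`. -/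
theorem eq_involFlow_of_apply_eq (hg : ∀ s x, g s x = Real.cosh s • x + Real.sinh s • J x) :
    g = involFlow J hJ := by
  funext s
  refine ContinuousLinearEquiv.ext (funext fun x => ?_)
  rw [hg s x]
  exact (involFlow_apply J hJ s x).symm

end Uniqueness

section Schwartz

variable {E F G : Type*} [NormedAddCommGroup E] [NormedSpace ℝ E] [NormedAddCommGroup F]
  [NormedSpace ℝ F] [NormedAddCommGroup G] [NormedSpace ℝ G]
variable (𝕜 : Type*) [RCLike 𝕜] [NormedSpace 𝕜 F] [SMulCommClass ℝ 𝕜 F]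
variable {J : E →L[ℝ] E} (hJ : J * J = 1) {g : ℝ → (E ≃L[ℝ] E)}
  (hg : ∀ s, ((g s : E ≃L[ℝ] E) : E →L[ℝ] E) = Real.cosh s • (1 : E →L[ℝ] E) + Real.sinh s • J)
include hJ hg

/-- **Differentiability of `Φ ↦ Φ ∘ g s` in the Schwartz topology at every base point**, for any family
`g` with matrices `cosh s · 1 + sinh s · J`. -/
theorem tendsto_compCLM_sub_div_at_of_coe_eq (Φ : 𝓢(E, F)) (s₀ : ℝ) :
    Tendsto (fun s : ℝ => s⁻¹ • (SchwartzMap.compCLMOfContinuousLinearEquiv 𝕜 (g (s₀ + s)) Φ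
        - SchwartzMap.compCLMOfContinuousLinearEquiv 𝕜 (g s₀) Φ)) (𝓝[≠] 0)
      (𝓝 (flowGen J (SchwartzMap.compCLMOfContinuousLinearEquiv 𝕜 (g s₀) Φ))) := by
  rw [eq_involFlow_of_coe_eq hJ hg]
  exact tendsto_compCLM_involFlow_sub_div_at 𝕜 J hJ Φ s₀

/-- Scalar coefficients `s ↦ T (Φ ∘ g s)` are differentiable with derivative `T (flowGen J (Φ ∘ g s₀))`. -/
theorem hasDerivAt_apply_compCLM_of_coe_eq (T : 𝓢(E, F) →L[ℝ] G) (Φ : 𝓢(E, F)) (s₀ : ℝ) :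
    HasDerivAt (fun s => T (SchwartzMap.compCLMOfContinuousLinearEquiv 𝕜 (g s) Φ))
      (T (flowGen J (SchwartzMap.compCLMOfContinuousLinearEquiv 𝕜 (g s₀) Φ))) s₀ := by
  rw [eq_involFlow_of_coe_eq hJ hg]
  exact hasDerivAt_apply_compCLM_involFlow 𝕜 J hJ T Φ s₀

/-- Scalar coefficients `s ↦ T (Φ ∘ g s)` are `C^∞`. -/
theorem contDiff_apply_compCLM_of_coe_eq (T : 𝓢(E, F) →L[ℝ] G) (Φ : 𝓢(E, F)) :
    ContDiff ℝ ∞ (fun s : ℝ => T (SchwartzMap.compCLMOfContinuousLinearEquiv 𝕜 (g s) Φ)) := by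
  rw [eq_involFlow_of_coe_eq hJ hg]
  exact contDiff_apply_compCLM_involFlow 𝕜 J hJ T Φ

/-- Their iterated derivatives. -/
theorem iteratedDeriv_apply_compCLM_of_coe_eq (T : 𝓢(E, F) →L[ℝ] G) (Φ : 𝓢(E, F)) (k : ℕ) :
    iteratedDeriv k (fun s : ℝ => T (SchwartzMap.compCLMOfContinuousLinearEquiv 𝕜 (g s) Φ))
      = fun s => T ((flowGen J)^[k] (SchwartzMap.compCLMOfContinuousLinearEquiv 𝕜 (g s) Φ)) := by
  rw [eq_involFlow_of_coe_eq hJ hg]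
  exact iteratedDeriv_apply_compCLM_involFlow 𝕜 J hJ T Φ k

end Schwartz

section Complex

variable {E F : Type*} [NormedAddCommGroup E] [NormedSpace ℝ E] [NormedAddCommGroup F]
  [NormedSpace ℝ F] [NormedSpace ℂ F] [IsScalarTower ℝ ℂ F] [SMulCommClass ℝ ℂ F]
variable {J : E →L[ℝ] E} (hJ : J * J = 1) {g : ℝ → (E ≃L[ℝ] E)}
  (hg : ∀ s, ((g s : E ≃L[ℝ] E) : E →L[ℝ] E) = Real.cosh s • (1 : E →L[ℝ] E) + Real.sinh s • J)
include hJ hg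

/-- **Complex scalars, every base point.** -/
theorem tendsto_compCLM_sub_div_ofReal_at_of_coe_eq (Φ : 𝓢(E, F)) (s₀ : ℝ) :
    Tendsto (fun s : ℝ => ((s : ℂ))⁻¹
        • (SchwartzMap.compCLMOfContinuousLinearEquiv ℂ (g (s₀ + s)) Φ
          - SchwartzMap.compCLMOfContinuousLinearEquiv ℂ (g s₀) Φ)) (𝓝[≠] 0)
      (𝓝 (flowGen J (SchwartzMap.compCLMOfContinuousLinearEquiv ℂ (g s₀) Φ))) := by
  rw [eq_involFlow_of_coe_eq hJ hg]
  exact tendsto_compCLM_involFlow_sub_div_ofReal_at J hJ Φ s₀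

/-- **Complex scalars at `0` — the literal smooth-vector-clause shape**:
`((s : ℂ))⁻¹ • (Φ ∘ g s - Φ) → flowGen J Φ` for any family `g` with matrices `cosh s · 1 + sinh s · J`. -/
theorem tendsto_compCLM_sub_div_ofReal_of_coe_eq (Φ : 𝓢(E, F)) :
    Tendsto (fun s : ℝ => ((s : ℂ))⁻¹
        • (SchwartzMap.compCLMOfContinuousLinearEquiv ℂ (g s) Φ - Φ)) (𝓝[≠] 0)
      (𝓝 (flowGen J Φ)) := by
  rw [eq_involFlow_of_coe_eq hJ hg]
  exact tendsto_compCLM_involFlow_sub_div_ofReal J hJ Φ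

end Complex

end SchwartzWeil
end HodgeCM
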